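import Mathlib.Algebra.BigOperators.Fin
import Mathlib.Algebra.Order.BigOperators.Group.Finset
import Mathlib.Data.Fintype.BigOperators
import Literature.Computability.Complexity.KarpProblems
import Literature.Computability.Complexity.OneInThreeSAT
import HarnessLib

/-!
# Weighted MAX CUT is NP-hard: the transformation from ONE-IN-THREE 3SAT, combinatorial half

Karp 1972 (Main Theorem, problem 21) / Garey–Johnson 1979 ([ND16], p. 210): weighted MAX CUT is
NP-complete. The tree states this as the named fact `isNPComplete_MAXCUT` (`KarpProblems.lean`:
instances `(⟨n, w⟩, W)`, `w : Fin n → Fin n → ℕ` a weight matrix, yes iff some `S ⊆ Fin n` has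
`W ≤ cutWeight w S = ∑ i ∈ S, ∑ j ∈ Sᶜ, w i j`). Karp's printed chain reaches MAX CUT from
PARTITION (`w(u,v) = c_u c_v`, `W = ⌈(∑ c)² / 4⌉`), Garey–Johnson's entry cites a transformation
from MAX 2-SAT; the tree's available NP-hard source with a proved machine is ONE-IN-THREE 3SAT
(`ONEIN3SAT`, `Schaefer1978_oneInThreeSAT_NPHard_holds`, `OneInThreeSATMachine.lean`), and this
file proves correct a direct transformation `ONE-IN-THREE 3SAT → weighted MAX CUT` (a "twin vertex
+ pole" gadget in the style of the textbook cut gadgets; this particular transformation is our own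
route to Karp's theorem, not Karp's or Garey–Johnson's printed one, and every claim about it is
proved here). Sequels (planned, same directory): the polynomial-time machine computing it on codes
(`MaxCutGadgetMachine.lean`, giving `ONEIN3SAT ≤ₚ MAXCUT`), membership `MAXCUT ∈ NP`
(`MaxCutNP.lean`), and the assembly `isNPComplete_MAXCUT_holds` (`KarpProblemsProofs.lean`).
Nothing here is a named fact; nothing is asserted about Karp's own PARTITION chain.

## The transformation (`OneInThreeMaxCut.inst φ`)

Let `φ` have `m` clauses, each of three (pairwise distinct) literals; occurrence `o = (i, j)`
(`i < m`, `j < 3`) carries the literal `lit φ o = (var, pol)`. Vertices (`Vtx m`): for every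
occurrence `o` a vertex `(o, ff)` and its TWIN `(o, tt)`, and one POLE; numbered
`(i, j, s) ↦ 6 i + 2 j + s`, pole `↦ 6 m` (`vEquiv`), so `n = 6 m + 1`. Symmetric weights
(`entry`, a sum of four 0/1 layers):
* twin layer `eTwin`: `{(o,ff), (o,tt)}` — weight 1;
* triangle layer `eTri`: `{(o,ff), (o',ff)}` for `o ≠ o'` in the same clause — weight 1;
* pole layer `ePole`: `{pole, (o,ff)}` — weight 1;
* consistency layer `eCons`: for `o ≠ o'` with the same variable, `{(o,s), (o',t)}` with
  `s ≠ t` if the polarities agree and `s = t` if they differ — weight 1.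
Target `W = 7 m + R`, `R = #{(o, o') ordered, o ≠ o', var o = var o'}`.

## Correctness (`inst_mem_maxCutSet_iff`)

For a cut (a side function `Vtx m → Bool`) the cut weight splits along the layers (`cutOf_add`):
the twin layer contributes `#{o | (o,ff), (o,tt) separated} ≤ 3 m` (`cutOf_eTwin`); pole and
triangle layers contribute, per clause, `clauseScore ≤ 4` with equality iff EXACTLY ONE of the
three occurrence vertices lies on the pole's side (`clauseScore_le`, `clauseScore_eq_four_iff`, a
16-case check); the consistency layer contributes at most `R` (`two_mul_cutOf_eCons_le`: the two
ordered pairs `(o,o')`, `(o',o)` together contribute `≤ 2`, a 32-case check, summed by symmetry).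
Hence `cut ≤ W`, and `cut ≥ W` forces every layer to its maximum: twins separated, every
same-variable pair consistent (`consScore_twin`), one true occurrence per clause — which is a
one-in-three satisfying assignment (`assignment`, `eval_assignment`); conversely such an
assignment defines a cut of weight exactly `W` (`cutOf_sideOf`).

## References

* R. M. Karp, *Reducibility among combinatorial problems*, in: Complexity of Computer
  Computations, Plenum 1972, Main Theorem, problem 21 (MAX CUT).
* M. R. Garey, D. S. Johnson, *Computers and Intractability*, Freeman 1979, [ND16] MAX CUT
  (p. 210), [LO4] ONE-IN-THREE 3SAT (p. 259).
-/

namespace Literature.Computability.Complexity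

open _root_.Computability Finset

namespace OneInThreeMaxCut

variable (φ : CNF ℕ) {m : ℕ}

/-! ### Occurrences, vertices, literals -/

/-- Occurrences of a formula with `m` three-literal clauses: (clause, position). [folklore] -/
abbrev Occ (m : ℕ) : Type := Fin m × Fin 3

/-- Vertices of the MAX CUT instance: `some (o, ff)` the occurrence vertex of `o`, `some (o, tt)`
its twin, `none` the pole. [folklore] -/
abbrev Vtx (m : ℕ) : Type := Option (Occ m × Bool)

/-- The literal at clause `i`, position `j`, read totally (junk `(0, false)` outside the formula).
[folklore] -/
def litN (i j : ℕ) : Literal ℕ := (φ.getD i []).getD j (0, false)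

/-- The literal of an occurrence. [folklore] -/
def lit (o : Occ m) : Literal ℕ := litN φ o.1 o.2

/-! ### The weight layers -/

/-- A weight function on occurrence vertices and twins, extended by `0` at the pole. [folklore] -/
def liftSS (F : Occ m × Bool → Occ m × Bool → ℕ) : Vtx m → Vtx m → ℕ
  | some p, some q => F p q
  | _, _ => 0

/-- Twin layer: `{(o,ff), (o,tt)}`. [folklore] -/
def eTwin : Vtx m → Vtx m → ℕ :=
  liftSS fun p q => if p.1 = q.1 then (p.2 != q.2).toNat else 0

/-- Triangle layer: occurrence vertices of distinct occurrences of one clause. [folklore] -/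
def eTri : Vtx m → Vtx m → ℕ :=
  liftSS fun p q => if p.1 = q.1 then 0 else if p.1.1 = q.1.1 then (!p.2 && !q.2).toNat else 0

/-- Pole layer: the pole against every occurrence vertex. [folklore] -/
def ePole : Vtx m → Vtx m → ℕ
  | none, some (_, s) => (!s).toNat
  | some (_, s), none => (!s).toNat
  | _, _ => 0

/-- Consistency layer: distinct occurrences of one variable, crossed (`s ≠ t`) for equal polarities,
straight (`s = t`) for opposite ones. [folklore] -/
def eCons : Vtx m → Vtx m → ℕ :=
  liftSS fun p q => if p.1 = q.1 then 0 else if (lit φ p.1).1 = (lit φ q.1).1 then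
    (decide ((lit φ p.1).2 = (lit φ q.1).2) == (p.2 != q.2)).toNat else 0

/-- **The weight matrix on structured vertices**: the sum of the four layers. [folklore] -/
def entry (v v' : Vtx m) : ℕ := eTwin v v' + eTri v v' + ePole v v' + eCons φ v v'

/-- The same-variable indicator of an ordered pair of distinct occurrences. [folklore] -/
def A (o o' : Occ m) : ℕ := if o = o' then 0 else if (lit φ o).1 = (lit φ o').1 then 1 else 0

/-- `R`: the number of ordered pairs of distinct occurrences of a common variable. [folklore] -/
def R (m : ℕ) : ℕ := ∑ o : Occ m, ∑ o' : Occ m, A φ o o'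

/-- The target weight `W = 7 m + R`. [folklore] -/
def W (m : ℕ) : ℕ := 7 * m + R φ m

/-! ### Cuts on structured vertices -/

/-- Indicator of an ordered pair cut from the `true` side to the `false` side. [folklore] -/
def δ (side : Vtx m → Bool) (v v' : Vtx m) : ℕ := (side v && !side v').toNat

/-- The weight cut by `side` in the layer `f`: `∑_{v, v'} [side v ∧ ¬ side v'] f v v'`. [folklore] -/
def cutOf (f : Vtx m → Vtx m → ℕ) (side : Vtx m → Bool) : ℕ := ∑ v, ∑ v', δ side v v' * f v v'

/-- `cutOf` is additive in the layer. [folklore] -/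
theorem cutOf_add (f g : Vtx m → Vtx m → ℕ) (side : Vtx m → Bool) :
    cutOf (fun v v' => f v v' + g v v') side = cutOf f side + cutOf g side := by
  simp only [cutOf, mul_add, Finset.sum_add_distrib]

/-- The cut weight of the whole matrix is the sum of the four layer cuts. [folklore] -/
theorem cutOf_entry (side : Vtx m → Bool) :
    cutOf (entry φ) side = cutOf eTwin side + cutOf eTri side + cutOf ePole side + cutOf (eCons φ) side := by
  unfold entry
  rw [← cutOf_add, ← cutOf_add, ← cutOf_add]

/-- A layer vanishing at the pole is cut inside the occurrence part. [folklore] -/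
theorem cutOf_liftSS (F : Occ m × Bool → Occ m × Bool → ℕ) (side : Vtx m → Bool) :
    cutOf (liftSS F) side =
      ∑ o : Occ m, ∑ o' : Occ m, ∑ s : Bool, ∑ t : Bool, δ side (some (o, s)) (some (o', t)) * F (o, s) (o', t) := by
  unfold cutOf
  rw [Fintype.sum_option]
  have h0 : ∑ v', δ side none v' * liftSS F none v' = 0 :=
    Finset.sum_eq_zero fun v' _ => by cases v' <;> simp [liftSS]
  rw [h0, zero_add, Fintype.sum_prod_type]
  refine Finset.sum_congr rfl fun o _ => ?_
  have h1 : ∀ s : Bool, ∑ v', δ side (some (o, s)) v' * liftSS F (some (o, s)) v' =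
      ∑ o', ∑ t, δ side (some (o, s)) (some (o', t)) * F (o, s) (o', t) := fun s => by
    rw [Fintype.sum_option, Fintype.sum_prod_type]
    simp [liftSS]
  simp only [h1]
  exact Finset.sum_comm

/-! ### The twin layer -/

/-- The twin term of an occurrence: its vertex and twin are separated. [folklore] -/
def twinTerm (side : Vtx m → Bool) (o : Occ m) : ℕ := (side (some (o, false)) != side (some (o, true))).toNat

/-- **Cut of the twin layer**: the number of separated twin pairs. [folklore] -/
theorem cutOf_eTwin (side : Vtx m → Bool) : cutOf eTwin side = ∑ o : Occ m, twinTerm side o := by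
  rw [eTwin, cutOf_liftSS]
  refine Finset.sum_congr rfl fun o _ => ?_
  rw [Finset.sum_eq_single o]
  · simp only [if_true, Fintype.sum_bool, δ, twinTerm]
    generalize side (some (o, false)) = x
    generalize side (some (o, true)) = y
    cases x <;> cases y <;> rfl
  · intro o' _ ho'
    simp [Ne.symm ho']
  · simp

/-- A twin term is at most `1`. [folklore] -/
theorem twinTerm_le (side : Vtx m → Bool) (o : Occ m) : twinTerm side o ≤ 1 := Bool.toNat_le _

/-! ### Pole and triangle layers: the clause score -/

/-- The score of a clause: pole edges to its three occurrence vertices plus the triangle on them,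
as a function of their sides `x₀ x₁ x₂` and the pole's side `sp`. [folklore] -/
def clauseScore (x₀ x₁ x₂ sp : Bool) : ℕ :=
  (sp != x₀).toNat + (sp != x₁).toNat + (sp != x₂).toNat +
    ((x₀ && !x₁).toNat + (x₀ && !x₂).toNat + (x₁ && !x₀).toNat + (x₁ && !x₂).toNat +
      (x₂ && !x₀).toNat + (x₂ && !x₁).toNat)

/-- **A clause scores at most `4`.** [folklore] -/
theorem clauseScore_le (x₀ x₁ x₂ sp : Bool) : clauseScore x₀ x₁ x₂ sp ≤ 4 := by
  revert x₀ x₁ x₂ sp; decide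

/-- **A clause scores `4` iff exactly one of its occurrence vertices is on the pole's side.**
[folklore] -/
theorem clauseScore_eq_four_iff (x₀ x₁ x₂ sp : Bool) :
    clauseScore x₀ x₁ x₂ sp = 4 ↔ (x₀ == sp).toNat + (x₁ == sp).toNat + (x₂ == sp).toNat = 1 := by
  revert x₀ x₁ x₂ sp; decide

/-- The side of the occurrence vertex of `o`. [folklore] -/
abbrev xOf (side : Vtx m → Bool) (o : Occ m) : Bool := side (some (o, false))

/-- The score of clause `i` under `side`. [folklore] -/
def G (side : Vtx m → Bool) (i : Fin m) : ℕ :=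
  clauseScore (xOf side (i, 0)) (xOf side (i, 1)) (xOf side (i, 2)) (side none)

/-- **Cut of the pole layer**: occurrence vertices opposite to the pole. [folklore] -/
theorem cutOf_ePole (side : Vtx m → Bool) :
    cutOf ePole side = ∑ o : Occ m, (side none != xOf side o).toNat := by
  unfold cutOf
  rw [Fintype.sum_option]
  have h0 : ∑ v', δ side none v' * ePole none v' = ∑ o : Occ m, δ side none (some (o, false)) := by
    rw [Fintype.sum_option, Fintype.sum_prod_type]
    simp [ePole]
  have h1 : ∑ p : Occ m × Bool, ∑ v', δ side (some p) v' * ePole (some p) v' =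
      ∑ o : Occ m, δ side (some (o, false)) none := by
    rw [Fintype.sum_prod_type]
    refine Finset.sum_congr rfl fun o _ => ?_
    rw [Fintype.sum_bool, Fintype.sum_option, Fintype.sum_option]
    simp [ePole]
  rw [h0, h1, ← Finset.sum_add_distrib]
  refine Finset.sum_congr rfl fun o _ => ?_
  simp only [δ, xOf]
  generalize side none = x
  generalize side (some (o, false)) = y
  cases x <;> cases y <;> rfl

/-- **Cut of the triangle layer**, clause by clause. [folklore] -/
theorem cutOf_eTri (side : Vtx m → Bool) :
    cutOf eTri side = ∑ i : Fin m, ∑ j : Fin 3, ∑ j' : Fin 3,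
      if j = j' then 0 else δ side (some ((i, j), false)) (some ((i, j'), false)) := by
  rw [eTri, cutOf_liftSS, Fintype.sum_prod_type]
  refine Finset.sum_congr rfl fun i _ => Finset.sum_congr rfl fun j _ => ?_
  rw [Fintype.sum_prod_type, Finset.sum_eq_single i]
  · refine Finset.sum_congr rfl fun j' _ => ?_
    simp only [Fintype.sum_bool, Prod.mk.injEq, true_and]
    by_cases h : j = j'
    · simp [h]
    · simp [h, δ]
  · intro i' _ hi'
    refine Finset.sum_eq_zero fun j' _ => ?_
    simp [Ne.symm hi']
  · simp

/-- **Triangle and pole layers together are the clause scores.** [folklore] -/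
theorem cutOf_eTri_add_cutOf_ePole (side : Vtx m → Bool) :
    cutOf eTri side + cutOf ePole side = ∑ i : Fin m, G side i := by
  rw [add_comm, cutOf_ePole, cutOf_eTri, Fintype.sum_prod_type, ← Finset.sum_add_distrib]
  refine Finset.sum_congr rfl fun i _ => ?_
  simp only [Fin.sum_univ_three, G, clauseScore, δ, xOf, Fin.isValue]
  simp only [show ((0 : Fin 3) = 1) = False by decide, show ((0 : Fin 3) = 2) = False by decide,
    show ((1 : Fin 3) = 0) = False by decide, show ((1 : Fin 3) = 2) = False by decide,
    show ((2 : Fin 3) = 0) = False by decide, show ((2 : Fin 3) = 1) = False by decide, if_true, if_false]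
  ring

/-- The clause scores total at most `4 m`. [folklore] -/
theorem sum_G_le (side : Vtx m → Bool) : ∑ i : Fin m, G side i ≤ 4 * m := by
  calc ∑ i : Fin m, G side i ≤ ∑ _i : Fin m, 4 := Finset.sum_le_sum fun i _ => clauseScore_le _ _ _ _
    _ = 4 * m := by simp [mul_comm]

/-! ### The consistency layer -/

/-- The score of an ordered pair of occurrences `(o, o')` in the consistency layer, as a function of
the sides `a, ā` of the vertex and twin of `o`, `b, b̄` of those of `o'`, and whether the polarities
agree. [folklore] -/
def consScore (a abar b bbar P : Bool) : ℕ :=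
  if P then (a && !bbar).toNat + (abar && !b).toNat else (a && !b).toNat + (abar && !bbar).toNat

/-- The two ordered pairs of one unordered pair score at most `2` together. [folklore] -/
theorem consScore_add_consScore_le (a abar b bbar P : Bool) :
    consScore a abar b bbar P + consScore b bbar a abar P ≤ 2 := by
  revert a abar b bbar P; decide

/-- With separated twins the score is the consistency indicator. [folklore] -/
theorem consScore_twin (a b P : Bool) :
    consScore a (!a) b (!b) P = (if P then (a == b) else (a != b)).toNat := by
  revert a b P; decide

/-- The score with separated twins is at most `1`. [folklore] -/
theorem consScore_twin_le (a b P : Bool) : consScore a (!a) b (!b) P ≤ 1 := by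
  rw [consScore_twin]; exact Bool.toNat_le _

/-- The consistency score of `(o, o')` under `side`. [folklore] -/
def cs (side : Vtx m → Bool) (o o' : Occ m) : ℕ :=
  consScore (side (some (o, false))) (side (some (o, true))) (side (some (o', false))) (side (some (o', true)))
    (decide ((lit φ o).2 = (lit φ o').2))

/-- **Cut of the consistency layer.** [folklore] -/
theorem cutOf_eCons (side : Vtx m → Bool) :
    cutOf (eCons φ) side = ∑ o : Occ m, ∑ o' : Occ m, A φ o o' * cs φ side o o' := by
  rw [eCons, cutOf_liftSS]
  refine Finset.sum_congr rfl fun o _ => Finset.sum_congr rfl fun o' _ => ?_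
  simp only [Fintype.sum_bool, A, cs, consScore, δ]
  by_cases h : o = o'
  · simp [h]
  · by_cases hv : (lit φ o).1 = (lit φ o').1
    · simp only [h, hv, if_true, if_false, one_mul]
      generalize side (some (o, false)) = a
      generalize side (some (o, true)) = abar
      generalize side (some (o', false)) = b
      generalize side (some (o', true)) = bbar
      generalize decide ((lit φ o).2 = (lit φ o').2) = P
      cases a <;> cases abar <;> cases b <;> cases bbar <;> cases P <;> rfl
    · simp [h, hv]

/-- `A` is symmetric. [folklore] -/
theorem A_comm (o o' : Occ m) : A φ o o' = A φ o' o := by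
  unfold A
  by_cases h : o = o'
  · simp [h]
  · simp only [h, Ne.symm h, if_false]
    by_cases hv : (lit φ o).1 = (lit φ o').1 <;> simp [hv, eq_comm]

/-- `A` is `0` or `1`. [folklore] -/
theorem A_le_one (o o' : Occ m) : A φ o o' ≤ 1 := by
  unfold A; split_ifs <;> omega

/-- **The consistency layer is cut at most `R` times** (by symmetry: a pair and its reverse score
at most `2` together). [folklore] -/
theorem two_mul_cutOf_eCons_le (side : Vtx m → Bool) : 2 * cutOf (eCons φ) side ≤ 2 * R φ m := by
  have hswap : cutOf (eCons φ) side = ∑ o : Occ m, ∑ o' : Occ m, A φ o o' * cs φ side o' o := by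
    rw [cutOf_eCons, Finset.sum_comm]
    refine Finset.sum_congr rfl fun o _ => Finset.sum_congr rfl fun o' _ => ?_
    rw [A_comm]
  have h2 : 2 * cutOf (eCons φ) side = ∑ o : Occ m, ∑ o' : Occ m, A φ o o' * (cs φ side o o' + cs φ side o' o) := by
    conv_lhs => rw [two_mul]; congr; rw [cutOf_eCons]; · skip
    rw [hswap, ← Finset.sum_add_distrib]
    refine Finset.sum_congr rfl fun o _ => ?_
    rw [← Finset.sum_add_distrib]
    refine Finset.sum_congr rfl fun o' _ => ?_
    ring
  rw [h2, R, Finset.mul_sum]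
  refine Finset.sum_le_sum fun o _ => ?_
  rw [Finset.mul_sum]
  refine Finset.sum_le_sum fun o' _ => ?_
  have hc : cs φ side o o' + cs φ side o' o ≤ 2 := by
    unfold cs
    rw [show decide ((lit φ o').2 = (lit φ o).2) = decide ((lit φ o).2 = (lit φ o').2) by
      simp only [eq_comm]]
    exact consScore_add_consScore_le _ _ _ _ _
  have hA := A_le_one φ o o'
  nlinarith

/-! ### The bound `cut ≤ W` and the case of equality -/

/-- `#Occ m = 3 m`. [folklore] -/
theorem card_occ (m : ℕ) : Fintype.card (Occ m) = 3 * m := by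
  simp [Fintype.card_prod, mul_comm]

/-- The twin layer is cut at most `3 m` times. [folklore] -/
theorem cutOf_eTwin_le (side : Vtx m → Bool) : cutOf eTwin side ≤ 3 * m := by
  rw [cutOf_eTwin]
  calc ∑ o : Occ m, twinTerm side o ≤ ∑ _o : Occ m, 1 := Finset.sum_le_sum fun o _ => twinTerm_le side o
    _ = 3 * m := by simp [mul_comm]

/-- **Every cut has weight at most `W`.** [folklore] -/
theorem cutOf_entry_le (side : Vtx m → Bool) : cutOf (entry φ) side ≤ W φ m := by
  rw [cutOf_entry, W, add_assoc (cutOf eTwin side), cutOf_eTri_add_cutOf_ePole]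
  · have h1 := cutOf_eTwin_le side
    have h2 := sum_G_le side
    have h3 := two_mul_cutOf_eCons_le φ side
    omega

/-- **A cut of weight `≥ W` maximises every layer**: all twins separated, every clause scores `4`,
the consistency layer is cut `R` times. [folklore] -/
theorem layers_of_le_cutOf {side : Vtx m → Bool} (h : W φ m ≤ cutOf (entry φ) side) :
    (∀ o : Occ m, twinTerm side o = 1) ∧ (∀ i : Fin m, G side i = 4) ∧ cutOf (eCons φ) side = R φ m := by
  rw [cutOf_entry, W, add_assoc (cutOf eTwin side), cutOf_eTri_add_cutOf_ePole] at h
  have h1 := cutOf_eTwin_le (m := m) side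
  have h2 := sum_G_le (m := m) side
  have h3 := two_mul_cutOf_eCons_le φ side
  have e1 : cutOf eTwin side = 3 * m := by omega
  have e2 : ∑ i : Fin m, G side i = 4 * m := by omega
  have e3 : cutOf (eCons φ) side = R φ m := by omega
  refine ⟨?_, ?_, e3⟩
  · have hs : ∑ o : Occ m, twinTerm side o = ∑ _o : Occ m, 1 := by
      rw [← cutOf_eTwin, e1]; simp [mul_comm]
    rw [Finset.sum_eq_sum_iff_of_le fun o _ => twinTerm_le side o] at hs
    exact fun o => hs o (Finset.mem_univ o)
  · have hs : ∑ i : Fin m, G side i = ∑ _i : Fin m, 4 := by rw [e2]; simp [mul_comm]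
    have hle : ∀ i ∈ (Finset.univ : Finset (Fin m)), G side i ≤ 4 := fun i _ => clauseScore_le _ _ _ _
    rw [Finset.sum_eq_sum_iff_of_le hle] at hs
    exact fun i => hs i (Finset.mem_univ i)

/-- Separated twins: the twin's side is the negation. [folklore] -/
theorem twin_eq_not {side : Vtx m → Bool} {o : Occ m} (h : twinTerm side o = 1) :
    side (some (o, true)) = !side (some (o, false)) := by
  unfold twinTerm at h
  revert h
  generalize side (some (o, false)) = x
  generalize side (some (o, true)) = y
  cases x <;> cases y <;> simp

/-- **Consistency from a maximal cut**: with all twins separated and the consistency layer cut `R`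
times, distinct occurrences of one variable lie on equal sides iff their polarities agree.
[folklore] -/
theorem consistent_of_layers {side : Vtx m → Bool} (ht : ∀ o : Occ m, twinTerm side o = 1)
    (hc : cutOf (eCons φ) side = R φ m) {o o' : Occ m} (hne : o ≠ o') (hv : (lit φ o).1 = (lit φ o').1) :
    xOf side o = xOf side o' ↔ (lit φ o).2 = (lit φ o').2 := by
  have hcs : ∀ p q : Occ m, cs φ side p q = consScore (xOf side p) (!xOf side p) (xOf side q) (!xOf side q)
      (decide ((lit φ p).2 = (lit φ q).2)) := fun p q => by
    rw [cs, twin_eq_not (ht p), twin_eq_not (ht q)]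
  rw [cutOf_eCons, R] at hc
  have hle : ∀ p ∈ (Finset.univ : Finset (Occ m)), ∑ q, A φ p q * cs φ side p q ≤ ∑ q, A φ p q := fun p _ =>
    Finset.sum_le_sum fun q _ => by
      rw [hcs]
      have := consScore_twin_le (xOf side p) (xOf side q) (decide ((lit φ p).2 = (lit φ q).2))
      have := A_le_one φ p q
      nlinarith
  rw [Finset.sum_eq_sum_iff_of_le hle] at hc
  have hrow := hc o (Finset.mem_univ o)
  have hle' : ∀ q ∈ (Finset.univ : Finset (Occ m)), A φ o q * cs φ side o q ≤ A φ o q := fun q _ => by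
    rw [hcs]
    have := consScore_twin_le (xOf side o) (xOf side q) (decide ((lit φ o).2 = (lit φ q).2))
    have := A_le_one φ o q
    nlinarith
  rw [Finset.sum_eq_sum_iff_of_le hle'] at hrow
  have h1 := hrow o' (Finset.mem_univ o')
  have hA : A φ o o' = 1 := by simp [A, hne, hv]
  rw [hA, one_mul, hcs, consScore_twin] at h1
  revert h1
  generalize xOf side o = a
  generalize xOf side o' = b
  by_cases hp : (lit φ o).2 = (lit φ o').2
  · simp only [hp, decide_true, if_true, iff_true]
    cases a <;> cases b <;> simp
  · simp only [hp, decide_false, iff_false]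
    cases a <;> cases b <;> simp

/-! ### From a maximal cut to a one-in-three assignment -/

/-- The truth value of an occurrence in a cut: its vertex lies on the pole's side. [folklore] -/
abbrev truth (side : Vtx m → Bool) (o : Occ m) : Bool := xOf side o == side none

/-- **The assignment read off a cut**: a variable takes the value making (any) one of its
occurrences evaluate to its truth value; unused variables are `false`. [folklore] -/
noncomputable def assignment (tr : Occ m → Bool) (v : ℕ) : Bool :=
  if h : ∃ o : Occ m, (lit φ o).1 = v then (tr h.choose == (lit φ h.choose).2) else false

/-- Under a consistent truth labelling, every occurrence evaluates to its label. [folklore] -/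
theorem eval_assignment {tr : Occ m → Bool}
    (hcons : ∀ o o' : Occ m, o ≠ o' → (lit φ o).1 = (lit φ o').1 → (tr o = tr o' ↔ (lit φ o).2 = (lit φ o').2))
    (o : Occ m) : Literal.eval (assignment φ tr) (lit φ o) = tr o := by
  have h : ∃ o' : Occ m, (lit φ o').1 = (lit φ o).1 := ⟨o, rfl⟩
  rw [Literal.eval, assignment, dif_pos h]
  have hv : (lit φ h.choose).1 = (lit φ o).1 := h.choose_spec
  generalize h.choose = o₀ at hv
  by_cases ho : o₀ = o
  · subst ho
    generalize tr o₀ = a; generalize (lit φ o₀).2 = b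
    cases a <;> cases b <;> rfl
  · have hc := hcons o₀ o ho hv
    revert hc
    generalize tr o₀ = a; generalize (lit φ o₀).2 = b; generalize tr o = a'; generalize (lit φ o).2 = b'
    cases a <;> cases b <;> cases a' <;> cases b' <;> simp

/-- In a formula of three-literal clauses, clause `i` is the list of its three occurrence literals.
[folklore] -/
theorem getElem_eq_triple (h3 : φ.IsThreeLiteralClauses) (i : Fin φ.length) :
    φ[(i : ℕ)] = [lit φ (i, 0), lit φ (i, 1), lit φ (i, 2)] := by
  have hmem : φ[(i : ℕ)] ∈ φ := List.getElem_mem _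
  obtain ⟨a, b, c, habc⟩ := List.length_eq_three.1 (h3 _ hmem).1
  have hD : φ.getD (i : ℕ) [] = φ[(i : ℕ)] := List.getD_eq_getElem _ _ i.isLt
  simp only [lit, litN, Fin.isValue, Fin.val_zero, Fin.val_one, Fin.val_two, hD, habc]
  rfl

/-- Counting true literals in a triple. [folklore] -/
theorem countP_triple (p : Literal ℕ → Bool) (a b c : Literal ℕ) :
    [a, b, c].countP p = (p a).toNat + (p b).toNat + (p c).toNat := by
  simp only [List.countP_cons, List.countP_nil]
  cases p a <;> cases p b <;> cases p c <;> rfl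

/-- **A cut of weight `≥ W` yields a one-in-three satisfying assignment.** [folklore] -/
theorem xSatisfiable_of_le_cutOf (h3 : φ.IsThreeLiteralClauses) {side : Vtx φ.length → Bool}
    (h : W φ φ.length ≤ cutOf (entry φ) side) : φ.XSatisfiable := by
  obtain ⟨ht, hG, hc⟩ := layers_of_le_cutOf φ h
  have hcons : ∀ o o' : Occ φ.length, o ≠ o' → (lit φ o).1 = (lit φ o').1 →
      (truth side o = truth side o' ↔ (lit φ o).2 = (lit φ o').2) := fun o o' hne hv => by
    rw [← consistent_of_layers φ ht hc hne hv]
    simp only [truth]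
    generalize xOf side o = a; generalize xOf side o' = b; generalize side none = c
    cases a <;> cases b <;> cases c <;> simp
  refine ⟨assignment φ (truth side), (CNF.xeval_eq_true_iff _ _).2 fun c hc' => ?_⟩
  obtain ⟨i, hi, rfl⟩ := List.getElem_of_mem hc'
  have hi' : φ[i] = [lit φ (⟨i, hi⟩, 0), lit φ (⟨i, hi⟩, 1), lit φ (⟨i, hi⟩, 2)] := getElem_eq_triple φ h3 ⟨i, hi⟩
  rw [hi', countP_triple, eval_assignment φ hcons, eval_assignment φ hcons, eval_assignment φ hcons]
  have hg := (clauseScore_eq_four_iff _ _ _ _).1 (hG ⟨i, hi⟩)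
  simpa [truth] using hg

/-! ### From a one-in-three assignment to a cut of weight `W` -/

/-- **The cut defined by an assignment**: occurrence vertices on the side of their truth value,
twins opposite, the pole on the `true` side. [folklore] -/
def sideOf (σ : ℕ → Bool) : Vtx m → Bool
  | none => true
  | some (o, s) => Literal.eval σ (lit φ o) != s

/-- **The cut of a one-in-three satisfying assignment has weight `W`.** [folklore] -/
theorem cutOf_sideOf (h3 : φ.IsThreeLiteralClauses) {σ : ℕ → Bool} (hσ : φ.xeval σ = true) :
    cutOf (entry φ) (sideOf φ σ : Vtx φ.length → Bool) = W φ φ.length := by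
  rw [cutOf_entry, W, add_assoc (cutOf eTwin _), cutOf_eTri_add_cutOf_ePole]
  have e1 : cutOf eTwin (sideOf φ σ : Vtx φ.length → Bool) = 3 * φ.length := by
    rw [cutOf_eTwin]
    have : ∀ o : Occ φ.length, twinTerm (sideOf φ σ) o = 1 := fun o => by
      simp only [twinTerm, sideOf]
      cases Literal.eval σ (lit φ o) <;> rfl
    simp [this, mul_comm]
  have e2 : ∑ i : Fin φ.length, G (sideOf φ σ) i = 4 * φ.length := by
    have : ∀ i : Fin φ.length, G (sideOf φ σ) i = 4 := fun i => by
      rw [G, clauseScore_eq_four_iff]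
      have hx := (CNF.xeval_eq_true_iff _ _).1 hσ _ (List.getElem_mem i.isLt)
      rw [getElem_eq_triple φ h3 i, countP_triple] at hx
      simpa [xOf, sideOf] using hx
    simp [this, mul_comm]
  have e3 : cutOf (eCons φ) (sideOf φ σ : Vtx φ.length → Bool) = R φ φ.length := by
    rw [cutOf_eCons, R]
    refine Finset.sum_congr rfl fun o _ => Finset.sum_congr rfl fun o' _ => ?_
    by_cases hne : o = o'
    · simp [A, hne]
    by_cases hv : (lit φ o).1 = (lit φ o').1
    · have hA : A φ o o' = 1 := by simp [A, hne, hv]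
      rw [hA, one_mul, cs]
      simp only [sideOf, Bool.bne_false, Bool.bne_true]
      rw [consScore_twin]
      by_cases hp : (lit φ o).2 = (lit φ o').2
      · have hl : lit φ o = lit φ o' := Prod.ext hv hp
        simp [hl]
      · have hl : lit φ o' = (lit φ o).negate := by
          refine Prod.ext hv.symm ?_
          simp only [Literal.negate]
          revert hp
          generalize (lit φ o).2 = a; generalize (lit φ o').2 = b
          cases a <;> cases b <;> simp
        rw [hl, Literal.eval_negate]
        simp [Literal.negate]
    · simp [A, hne, hv]
  omega

/-! ### The instance on `Fin (6 m + 1)` -/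

/-- The vertex number of a structured vertex: `(i, j, s) ↦ 6 i + 2 j + s`, pole `↦ 6 m`. [folklore] -/
def enc (m : ℕ) : Vtx m → Fin (6 * m + 1)
  | none => ⟨6 * m, by omega⟩
  | some ((i, j), s) => ⟨6 * i + 2 * j + s.toNat, by
      have := i.isLt; have := j.isLt; have := Bool.toNat_le s; omega⟩

/-- The structured vertex of a vertex number, totally on `ℕ` (numbers `≥ 6 m` are the pole).
[folklore] -/
def decN (m a : ℕ) : Vtx m :=
  if h : a < 6 * m then
    some ((⟨a / 6, by omega⟩, ⟨a % 6 / 2, by omega⟩), decide (a % 2 = 1))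
  else none

/-- The structured vertex of a vertex number. [folklore] -/
def dec (m : ℕ) (a : Fin (6 * m + 1)) : Vtx m := decN m a

/-- **Block form of `decN`**: vertex number `6 i + r`, `r < 6`, is occurrence `(i, r / 2)`, twin bit
`r % 2`. [folklore] -/
theorem decN_block {m i r : ℕ} (hi : i < m) (hr : r < 6) :
    decN m (6 * i + r) = some ((⟨i, hi⟩, ⟨r / 2, by omega⟩), decide (r % 2 = 1)) := by
  have hlt : 6 * i + r < 6 * m := by omega
  simp only [decN, hlt, dif_pos, Option.some.injEq, Prod.mk.injEq, Fin.mk.injEq]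
  refine ⟨⟨by omega, by omega⟩, ?_⟩
  exact decide_eq_decide.mpr (by omega)

/-- The pole's number decodes to the pole. [folklore] -/
theorem decN_pole (m : ℕ) : decN m (6 * m) = none := by simp [decN]

/-- `dec` inverts `enc`. [folklore] -/
theorem dec_enc (m : ℕ) (v : Vtx m) : dec m (enc m v) = v := by
  rcases v with _ | ⟨⟨i, j⟩, s⟩
  · simp [enc, dec, decN]
  · have hj := j.isLt
    have hs : s.toNat ≤ 1 := Bool.toNat_le s
    have e : 6 * (i : ℕ) + 2 * j + s.toNat = 6 * i + (2 * j + s.toNat) := by ring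
    show decN m (6 * (i : ℕ) + 2 * j + s.toNat) = _
    rw [e, decN_block i.isLt (by omega)]
    simp only [Option.some.injEq, Prod.mk.injEq, true_and]
    refine ⟨Fin.ext ?_, ?_⟩
    · simp only; omega
    · cases s <;> simp

/-- `enc` inverts `dec`. [folklore] -/
theorem enc_dec (m : ℕ) (a : Fin (6 * m + 1)) : enc m (dec m a) = a := by
  unfold dec decN
  split_ifs with h
  · refine Fin.ext ?_
    simp only [enc]
    rcases Nat.mod_two_eq_zero_or_one a with h2 | h2
    · simp only [h2, zero_ne_one, decide_false, Bool.toNat_false]; omega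
    · simp only [h2, decide_true, Bool.toNat_true]; omega
  · refine Fin.ext ?_
    simp only [enc]
    have := a.isLt; omega

/-- **The vertex numbering** `Vtx m ≃ Fin (6 m + 1)`. [folklore] -/
def vEquiv (m : ℕ) : Vtx m ≃ Fin (6 * m + 1) where
  toFun := enc m
  invFun := dec m
  left_inv := dec_enc m
  right_inv := enc_dec m

/-- Number of an occurrence vertex / twin. [folklore] -/
@[simp] theorem vEquiv_some_val (m : ℕ) (i : Fin m) (j : Fin 3) (s : Bool) :
    ((vEquiv m (some ((i, j), s)) : Fin (6 * m + 1)) : ℕ) = 6 * i + 2 * j + s.toNat := rfl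

/-- Number of the pole. [folklore] -/
@[simp] theorem vEquiv_none_val (m : ℕ) : ((vEquiv m none : Fin (6 * m + 1)) : ℕ) = 6 * m := rfl

/-- The inverse numbering is `decN` on the value. [folklore] -/
theorem vEquiv_symm_apply (m : ℕ) (a : Fin (6 * m + 1)) : (vEquiv m).symm a = decN m a := rfl

/-- The number of vertices `n = 6 m + 1`. [folklore] -/
abbrev nV : ℕ := 6 * φ.length + 1

/-- **The weight matrix of the instance** on `Fin (6 m + 1)`. [folklore] -/
def matrix : Fin (nV φ) → Fin (nV φ) → ℕ := fun a b =>
  entry φ ((vEquiv φ.length).symm a) ((vEquiv φ.length).symm b)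

/-- The matrix on numbered structured vertices. [folklore] -/
@[simp] theorem matrix_vEquiv (v v' : Vtx φ.length) :
    matrix φ (vEquiv φ.length v) (vEquiv φ.length v') = entry φ v v' := by
  simp [matrix]

/-- **The MAX CUT instance of `φ`**: `(⟨6 m + 1, matrix⟩, W)`. [folklore] -/
def inst : (Σ n, Fin n → Fin n → ℕ) × ℕ := (⟨nV φ, matrix φ⟩, W φ φ.length)

/-- **The tree's cut weight of the instance matrix is the structured cut weight** of the side
function of the vertex set. [folklore] -/
theorem cutWeight_matrix (S : Finset (Fin (nV φ))) :
    cutWeight (matrix φ) S = cutOf (entry φ) (fun v => decide (vEquiv φ.length v ∈ S)) := by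
  have h1 : cutWeight (matrix φ) S = ∑ a, ∑ b, (decide (a ∈ S) && !decide (b ∈ S)).toNat * matrix φ a b := by
    unfold cutWeight
    have hi : ∀ a, ∑ b ∈ Sᶜ, matrix φ a b = ∑ b, if b ∈ Sᶜ then matrix φ a b else 0 := fun a => by
      rw [Finset.sum_ite_mem, Finset.univ_inter]
    have ho : ∑ a ∈ S, ∑ b ∈ Sᶜ, matrix φ a b = ∑ a, if a ∈ S then ∑ b ∈ Sᶜ, matrix φ a b else 0 := by
      rw [Finset.sum_ite_mem, Finset.univ_inter]
    rw [ho]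
    refine Finset.sum_congr rfl fun a _ => ?_
    rw [hi]
    by_cases ha : a ∈ S
    · simp only [ha, if_true, decide_true, Bool.true_and]
      refine Finset.sum_congr rfl fun b _ => ?_
      by_cases hb : b ∈ S <;> simp [hb]
    · simp [ha]
  rw [h1, cutOf, ← Equiv.sum_comp (vEquiv φ.length)]
  refine Finset.sum_congr rfl fun v _ => ?_
  rw [← Equiv.sum_comp (vEquiv φ.length)]
  refine Finset.sum_congr rfl fun v' _ => ?_
  rw [matrix_vEquiv, δ]

/-- **Correctness of the transformation**: for a formula of three-literal clauses, the instance has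
a cut of weight `≥ W` iff the formula is one-in-three satisfiable. [folklore] -/
theorem inst_mem_maxCutSet_iff (h3 : φ.IsThreeLiteralClauses) : inst φ ∈ maxCutSet ↔ φ.XSatisfiable := by
  change (∃ S : Finset (Fin (nV φ)), W φ φ.length ≤ cutWeight (matrix φ) S) ↔ _
  constructor
  · rintro ⟨S, hS⟩
    rw [cutWeight_matrix] at hS
    exact xSatisfiable_of_le_cutOf φ h3 hS
  · rintro ⟨σ, hσ⟩
    refine ⟨Finset.univ.filter fun a => sideOf φ σ ((vEquiv φ.length).symm a) = true, ?_⟩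
    rw [cutWeight_matrix]
    have hs : (fun v : Vtx φ.length => decide (vEquiv φ.length v ∈
        Finset.univ.filter fun a => sideOf φ σ ((vEquiv φ.length).symm a) = true)) = sideOf φ σ := by
      funext v; simp
    rw [hs, cutOf_sideOf φ h3 hσ]

/-! ### Loop-friendly forms for the machine: entries and `R` by natural-number indices -/

/-- **The entry between occurrence vertices by indices**: for `(i, j, s)` against `(i', j', t)`,
`[s ≠ t]` for the same occurrence (twin layer), otherwise triangle indicator plus consistency
indicator. [folklore] -/
def entryN (i j : ℕ) (s : Bool) (i' j' : ℕ) (t : Bool) : ℕ :=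
  if i = i' ∧ j = j' then (s != t).toNat
  else (if i = i' then (!s && !t).toNat else 0) +
    (if (litN φ i j).1 = (litN φ i' j').1 then (decide ((litN φ i j).2 = (litN φ i' j').2) == (s != t)).toNat else 0)

/-- `entry` between occurrence vertices is `entryN` of the indices. [folklore] -/
theorem entry_some_some (i i' : Fin m) (j j' : Fin 3) (s t : Bool) :
    entry φ (some ((i, j), s)) (some ((i', j'), t)) = entryN φ i j s i' j' t := by
  simp only [entry, eTwin, eTri, ePole, eCons, liftSS, lit, entryN, Prod.mk.injEq, Fin.ext_iff, add_zero]
  by_cases h : (i : ℕ) = i' ∧ (j : ℕ) = j'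
  · simp [h]
  · simp only [h, if_false, zero_add]
    split_ifs <;> rfl

/-- `entry` at the pole. [folklore] -/
theorem entry_none_none : entry φ (none : Vtx m) none = 0 := rfl

/-- `entry` from the pole to an occurrence vertex or twin. [folklore] -/
theorem entry_none_some (o : Occ m) (s : Bool) : entry φ none (some (o, s)) = (!s).toNat := by
  simp [entry, eTwin, eTri, ePole, eCons, liftSS]

/-- `entry` from an occurrence vertex or twin to the pole. [folklore] -/
theorem entry_some_none (o : Occ m) (s : Bool) : entry φ (some (o, s)) none = (!s).toNat := by
  simp [entry, eTwin, eTri, ePole, eCons, liftSS]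

/-- **The matrix as a total function of vertex NUMBERS.** [folklore] -/
def entryNat (m a b : ℕ) : ℕ := entry φ (decN m a) (decN m b)

/-- The instance matrix is `entryNat` on the values. [folklore] -/
theorem matrix_apply (a b : Fin (nV φ)) : matrix φ a b = entryNat φ φ.length a b := rfl

/-- `entryNat` between block positions `6 i + r`, `6 i' + r'` (`r, r' < 6`). [folklore] -/
theorem entryNat_block {m i i' r r' : ℕ} (hi : i < m) (hi' : i' < m) (hr : r < 6) (hr' : r' < 6) :
    entryNat φ m (6 * i + r) (6 * i' + r') =
      entryN φ i (r / 2) (decide (r % 2 = 1)) i' (r' / 2) (decide (r' % 2 = 1)) := by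
  rw [entryNat, decN_block hi hr, decN_block hi' hr', entry_some_some]

/-- `entryNat` from a block position to the pole. [folklore] -/
theorem entryNat_block_pole {m i r : ℕ} (hi : i < m) (hr : r < 6) :
    entryNat φ m (6 * i + r) (6 * m) = (!decide (r % 2 = 1)).toNat := by
  rw [entryNat, decN_block hi hr, decN_pole, entry_some_none]

/-- `entryNat` from the pole to a block position. [folklore] -/
theorem entryNat_pole_block {m i' r' : ℕ} (hi' : i' < m) (hr' : r' < 6) :
    entryNat φ m (6 * m) (6 * i' + r') = (!decide (r' % 2 = 1)).toNat := by
  rw [entryNat, decN_block hi' hr', decN_pole, entry_none_some]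

/-- `entryNat` at the pole. [folklore] -/
theorem entryNat_pole_pole (m : ℕ) : entryNat φ m (6 * m) (6 * m) = 0 := by
  rw [entryNat, decN_pole, entry_none_none]

/-- The six (position, twin bit) slots of a clause block, in vertex order `2 j + s`. [folklore] -/
def slots : List (ℕ × Bool) := [(0, false), (0, true), (1, false), (1, true), (2, false), (2, true)]

/-- **Row `(i, j, s)` of the matrix in column order**: blocks of six entries for `i' < m`, then the
pole column. [folklore] -/
def rowNat (m i j : ℕ) (s : Bool) : List ℕ :=
  ((List.range m).flatMap fun i' => slots.map fun p => entryN φ i j s i' p.1 p.2) ++ [(!s).toNat]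

/-- **The pole row**: `1 0 1 0 1 0` per block, then `0`. [folklore] -/
def poleRow (m : ℕ) : List ℕ := ((List.range m).flatMap fun _ => slots.map fun p => (!p.2).toNat) ++ [0]

/-- **The entries of the matrix in row-major order**, in the block structure the machine emits: for
`i < m` the six rows `(i, j, s)`, then the pole row. [folklore] -/
def entriesNat (m : ℕ) : List ℕ :=
  ((List.range m).flatMap fun i => slots.flatMap fun p => rowNat φ m i p.1 p.2) ++ poleRow m

/-- `List.ofFn` through a function of the value is a `map` over `List.range`. [folklore] -/
theorem ofFn_eq_range_map {α : Type} (k : ℕ) (g : ℕ → α) : List.ofFn (fun i : Fin k => g i) = (List.range k).map g := by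
  apply List.ext_getElem <;> simp

/-- Row-major reading of a `k × c` index range. [folklore] -/
theorem range_mul_map_divMod {α : Type} (f : ℕ → ℕ → α) (c : ℕ) : ∀ k : ℕ,
    (List.range (k * c)).map (fun x => f (x / c) (x % c)) = (List.range k).flatMap fun a => (List.range c).map (f a)
  | 0 => by simp
  | k + 1 => by
    rw [Nat.succ_mul, List.range_add, List.map_append, range_mul_map_divMod f c k, List.range_succ,
      List.flatMap_append, List.flatMap_cons, List.flatMap_nil, List.append_nil, List.map_map]
    congr 1
    refine List.map_congr_left fun b hb => ?_
    have hb' : b < c := List.mem_range.1 hb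
    have hc : 0 < c := by omega
    have e1 : (k * c + b) / c = k := by
      rw [Nat.add_comm, Nat.add_mul_div_right _ _ hc, Nat.div_eq_of_lt hb', Nat.zero_add]
    have e2 : (k * c + b) % c = b := by
      rw [Nat.add_comm, Nat.add_mul_mod_self_right, Nat.mod_eq_of_lt hb']
    simp only [Function.comp_apply, e1, e2]

/-- A range of length `c m` in blocks of `c`. [folklore] -/
theorem range_mul_eq_flatMap (c : ℕ) : ∀ m : ℕ, List.range (c * m) = (List.range m).flatMap fun i => (List.range c).map (c * i + ·)
  | 0 => by simp
  | m + 1 => by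
    rw [Nat.mul_succ, List.range_add, range_mul_eq_flatMap c m, List.range_succ, List.flatMap_append,
      List.flatMap_cons, List.flatMap_nil, List.append_nil]

/-- Peeling the last index off a `flatMap` over a range. [folklore] -/
theorem flatMap_range_succ {α : Type} (f : ℕ → List α) (k : ℕ) :
    (List.range (k + 1)).flatMap f = (List.range k).flatMap f ++ f k := by
  rw [List.range_succ, List.flatMap_append, List.flatMap_cons, List.flatMap_nil, List.append_nil]

/-- Row `6 i + r` of `entryNat` read over the columns `< 6 m + 1` is `rowNat i (r/2) (r%2)`.
[folklore] -/
theorem map_entryNat_block {m i r : ℕ} (hi : i < m) (hr : r < 6) :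
    (List.range (6 * m + 1)).map (entryNat φ m (6 * i + r)) = rowNat φ m i (r / 2) (decide (r % 2 = 1)) := by
  rw [List.range_succ, List.map_append, List.map_singleton, rowNat, entryNat_block_pole φ hi hr,
    range_mul_eq_flatMap, List.map_flatMap]
  congr 1
  refine List.flatMap_congr fun i' hi' => ?_
  have hi'' : i' < m := List.mem_range.1 hi'
  simp only [slots, List.map_cons, List.map_nil,
    show List.range 6 = [0, 1, 2, 3, 4, 5] from rfl,
    entryNat_block φ hi hi'' hr (show 0 < 6 by norm_num), entryNat_block φ hi hi'' hr (show 1 < 6 by norm_num),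
    entryNat_block φ hi hi'' hr (show 2 < 6 by norm_num), entryNat_block φ hi hi'' hr (show 3 < 6 by norm_num),
    entryNat_block φ hi hi'' hr (show 4 < 6 by norm_num), entryNat_block φ hi hi'' hr (show 5 < 6 by norm_num)]
  norm_num

/-- The pole row of `entryNat`. [folklore] -/
theorem map_entryNat_pole (m : ℕ) : (List.range (6 * m + 1)).map (entryNat φ m (6 * m)) = poleRow m := by
  rw [List.range_succ, List.map_append, List.map_singleton, poleRow, entryNat_pole_pole,
    range_mul_eq_flatMap, List.map_flatMap]
  congr 1
  refine List.flatMap_congr fun i' hi' => ?_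
  have hi'' : i' < m := List.mem_range.1 hi'
  simp only [slots, List.map_cons, List.map_nil,
    show List.range 6 = [0, 1, 2, 3, 4, 5] from rfl,
    entryNat_pole_block φ hi'' (show 0 < 6 by norm_num), entryNat_pole_block φ hi'' (show 1 < 6 by norm_num),
    entryNat_pole_block φ hi'' (show 2 < 6 by norm_num), entryNat_pole_block φ hi'' (show 3 < 6 by norm_num),
    entryNat_pole_block φ hi'' (show 4 < 6 by norm_num), entryNat_pole_block φ hi'' (show 5 < 6 by norm_num)]
  norm_num

/-- **The row-major entry list of the instance matrix is `entriesNat`** (the list the machine of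
`MaxCutGadgetMachine.lean` emits). [folklore] -/
theorem ofFn_matrix :
    List.ofFn (fun k : Fin (nV φ * nV φ) => matrix φ (finProdFinEquiv.symm k).1 (finProdFinEquiv.symm k).2) =
      entriesNat φ φ.length := by
  have h1 : (fun k : Fin (nV φ * nV φ) => matrix φ (finProdFinEquiv.symm k).1 (finProdFinEquiv.symm k).2) =
      fun k : Fin (nV φ * nV φ) => entryNat φ φ.length ((k : ℕ) / nV φ) ((k : ℕ) % nV φ) := by
    funext k
    simp [matrix_apply]
  rw [h1, ofFn_eq_range_map (nV φ * nV φ) (fun x => entryNat φ φ.length (x / nV φ) (x % nV φ)),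
    range_mul_map_divMod, entriesNat, show nV φ = 6 * φ.length + 1 from rfl, flatMap_range_succ, map_entryNat_pole]
  congr 1
  rw [range_mul_eq_flatMap, List.flatMap_assoc]
  refine List.flatMap_congr fun i hi => ?_
  have hi' : i < φ.length := List.mem_range.1 hi
  simp only [List.flatMap_map, slots, List.flatMap_cons, List.flatMap_nil, List.append_nil,
    show List.range 6 = [0, 1, 2, 3, 4, 5] from rfl,
    map_entryNat_block φ hi' (show 0 < 6 by norm_num), map_entryNat_block φ hi' (show 1 < 6 by norm_num),
    map_entryNat_block φ hi' (show 2 < 6 by norm_num), map_entryNat_block φ hi' (show 3 < 6 by norm_num),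
    map_entryNat_block φ hi' (show 4 < 6 by norm_num), map_entryNat_block φ hi' (show 5 < 6 by norm_num)]
  norm_num

/-- **The code of the instance matrix** (for `encodingNatMatrixFin`) is the `listBool` code of
`entriesNat`. [folklore] -/
theorem encode_matrix :
    (encodingNatMatrixFin (nV φ)).encode (matrix φ) = encodingListNatBool.encode (entriesNat φ φ.length) := by
  rw [← ofFn_matrix]
  rfl

/-- **The code of the instance** (for the encoding of `MAXCUT`). [folklore] -/
theorem encode_inst :
    (encodingNatMatrix.pairBool encodingNatBool).encode (inst φ) =
      boolPair (boolPair (encodeNat (nV φ)) (encodingListNatBool.encode (entriesNat φ φ.length)))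
        (encodeNat (W φ φ.length)) := by
  rw [← encode_matrix]
  rfl

/-- The same-variable indicator by indices. [folklore] -/
def AN (i j i' j' : ℕ) : ℕ :=
  if i = i' ∧ j = j' then 0 else if (litN φ i j).1 = (litN φ i' j').1 then 1 else 0

/-- The block of `R` for clauses `i`, `i'`: same-variable pairs among their `3 × 3` positions.
[folklore] -/
def rBlock (i i' : ℕ) : ℕ := ∑ j ∈ Finset.range 3, ∑ j' ∈ Finset.range 3, AN φ i j i' j'

/-- **`R` as a double sum over clause indices** (the shape of the machine's sum folds). [folklore] -/
theorem R_eq_sum_rBlock (m : ℕ) :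
    R φ m = ∑ i ∈ Finset.range m, ∑ i' ∈ Finset.range m, rBlock φ i i' := by
  have inner : ∀ (i : Fin m) (j : Fin 3), ∑ o' : Occ m, A φ (i, j) o' =
      ∑ i' ∈ Finset.range m, ∑ j' ∈ Finset.range 3, AN φ i j i' j' := fun i j => by
    rw [Fintype.sum_prod_type,
      ← Fin.sum_univ_eq_sum_range (fun i' => ∑ j' ∈ Finset.range 3, AN φ (i : ℕ) (j : ℕ) i' j') m]
    refine Finset.sum_congr rfl fun i' _ => ?_
    rw [← Fin.sum_univ_eq_sum_range (fun j' => AN φ (i : ℕ) (j : ℕ) (i' : ℕ) j') 3]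
    refine Finset.sum_congr rfl fun j' _ => ?_
    simp only [A, AN, lit, Prod.mk.injEq, Fin.ext_iff]
    split_ifs <;> rfl
  have row : ∀ i : Fin m, ∑ j : Fin 3, ∑ o' : Occ m, A φ (i, j) o' = ∑ i' ∈ Finset.range m, rBlock φ i i' := fun i => by
    simp only [inner]
    rw [Finset.sum_comm]
    refine Finset.sum_congr rfl fun i' _ => ?_
    rw [rBlock, ← Fin.sum_univ_eq_sum_range (fun j => ∑ j' ∈ Finset.range 3, AN φ (i : ℕ) j (i' : ℕ) j') 3]
  rw [R, Fintype.sum_prod_type]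
  simp only [row]
  exact Fin.sum_univ_eq_sum_range (fun i => ∑ i' ∈ Finset.range m, rBlock φ i i') m

end OneInThreeMaxCut

end Literature.Computability.Complexity
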